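import Mathlib
import HarnessLib
import Literature.Dynamics.Hyperbolic.RGFlowStableManifoldTuningMap

/-!
# The second fixed point of the fine tuning ([ABKM19] Lemma 12.6) INSIDE AN INVARIANT SUBSPACE:
# if the steps preserve closed subspaces `V_k ⊆ E_k`, `W_k ⊆ F_k`, the tuned initial Hamiltonian can be
# taken in `V_0`

In the application of [ABKM19] Ch. 12 to COMPLEX gradient perturbations obeying the reflection symmetry
`ι : F(φ) ↦ conj F(−φ)`, every map of the renormalisation group preserves the `ι`-symmetric classes
(real constant and quadratic, imaginary linear coefficients for the relevant Hamiltonians; `K(X,−φ) =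
conj K(X,φ)` for the activities), and the point of the construction is that the TUNED initial
Hamiltonian `ℋ⋆ = Π_{H_0} Ẑ(𝒦, ℋ⋆)` of Lemma 12.6 lies in that class (so that the fine-tuned quadratic form
is real).  This file is the abstract bookkeeping: given the data of
`RGFlowStableManifoldTuningMap.exists_isTunedQ_initial_eq_of_parametrised` together with closed
submodules `V_k ⊆ E_k` and subgroups `W_k ⊆ F_k` such that `A^p_k V_k = V_{k+1}`, `B^p_k W_k ⊆ V_{k+1}`,
`S^p_k(V_k × W_k) ⊆ W_{k+1}` (`k < N`) for `p` in the ball and `y₀(V_0) ⊆ W_0`, the parametrised Lemma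
12.6 is applied to the RESTRICTED system on `(V_k, W_k)` (Brouwer in the finite-dimensional `V_0`):

* **`RGFlow.exists_isTunedQ_initial_eq_of_invariant`** — there is `h⋆ ∈ V_0`, `‖h⋆‖ ≤ ρ`, and a
  tuned relevant trajectory `x` of the ORIGINAL system with parameter `qmap h⋆`, started from `y₀ h⋆`,
  in the `ε`-tube, with `x_k ∈ V_k` (`k ≤ N`) and `x_0 = h⋆`.

Everything is proved; no named fact.

## References
* S. Adams, S. Buchholz, R. Kotecký, S. Müller, arXiv:1910.13564, Lemma 12.6, Ch. 4 (the
  representation needs a REAL fine-tuned quadratic form) [AdamsBuchholzKoteckyMuller2019].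
-/

noncomputable section

open Set Function Metric Filter
open scoped NNReal Topology

namespace Literature.Dynamics.Hyperbolic

namespace RGFlow

variable {E : ℕ → Type*} [∀ k, NormedAddCommGroup (E k)] [∀ k, NormedSpace ℝ (E k)]
  {F : ℕ → Type*} [∀ k, AddCommGroup (F k)]

section invariant

variable [∀ k, CompleteSpace (E k)] {N : ℕ} {r α β σ η κ ε ρ a₁ b₁ l₁ m₀ c₀ Lq : ℝ}
  {Q : ∀ k, F k → ℝ → Prop} {Λ : Type*}
  {A : Λ → ∀ k, E k ≃L[ℝ] E (k + 1)} {B : Λ → ∀ k, F k →+ E (k + 1)}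
  {S : Λ → ∀ k, E k → F k → F (k + 1)} {y₀ : E 0 → F 0}

set_option maxHeartbeats 800000 in
/-- **Lemma 12.6 inside an invariant subspace** (module docstring). The hypotheses are those of
`exists_isTunedQ_initial_eq_of_parametrised` plus: `V_k` closed submodules and `W_k` subgroups with
`A^p_k V_k ⊆ V_{k+1}`, `(A^p_k)⁻¹ V_{k+1} ⊆ V_k` (all `k`), `B^p_k W_k ⊆ V_{k+1}`, `S^p_k(V_k × W_k) ⊆ W_{k+1}`
(`k < N`) for `p ∈ ball`, and `y₀ h ∈ W_0` for `h ∈ V_0`, `‖h‖ ≤ ρ`.  Conclusion: the tuned `h⋆` and the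
whole tuned relevant trajectory lie in the subspaces. [cite: AdamsBuchholzKoteckyMuller2019, Lemma 12.6] -/
theorem exists_isTunedQ_initial_eq_of_invariant [FiniteDimensional ℝ (E 0)]
    (dist : Λ → Λ → ℝ) (ball : Set Λ) (qmap : E 0 → Λ)
    (V : ∀ k, Submodule ℝ (E k)) (W : ∀ k, AddSubgroup (F k)) (hVc : ∀ k, IsClosed (V k : Set (E k)))
    (hQ : IsSubaddNormBound Q) (hQnn : ∀ k, k < N → ∀ (v : F k) (c : ℝ), Q k v c → 0 ≤ c)
    (hη : 0 < η) (hη1 : η ≤ 1)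
    (hα : 0 ≤ α) (hβ : 0 ≤ β) (hκ₁ : α * (η + β) ≤ κ) (hκ₂ : σ ≤ κ * η)
    (hκ : κ < 1) (hε : 0 ≤ ε) (hεr : ε ≤ r) (hερ : ε ≤ ρ) (ha1 : 0 ≤ a₁) (hb1 : 0 ≤ b₁)
    (hl1 : 0 ≤ l₁) (hLq : 0 ≤ Lq) (hc₀ : c₀ ≤ ε)
    (hmaps : ∀ h : E 0, ‖h‖ ≤ ρ → qmap h ∈ ball)
    (hlip : ∀ h h' : E 0, ‖h‖ ≤ ρ → ‖h'‖ ≤ ρ → dist (qmap h) (qmap h') ≤ Lq * ‖h - h'‖)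
    (hT : ∀ p, p ∈ ball → IsRGStepQ N r α β σ Q (A p) (B p) (S p))
    (hy₀ : ∀ h : E 0, ‖h‖ ≤ ρ → Q 0 (y₀ h) c₀)
    (ha : ∀ p p', p ∈ ball → p' ∈ ball → ∀ k, k < N → ∀ w : E (k + 1),
      ‖(A p k).symm w - (A p' k).symm w‖ ≤ a₁ * dist p p' * ‖w‖)
    (hb : ∀ p p', p ∈ ball → p' ∈ ball → ∀ k, k < N → ∀ (v : F k) (c : ℝ), Q k v c →
      ‖B p k v - B p' k v‖ ≤ b₁ * dist p p' * c)
    (hl : ∀ p p', p ∈ ball → p' ∈ ball → ∀ k, k < N → ∀ (u : E k) (v : F k) (c : ℝ),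
      ‖u‖ ≤ r → Q k v c → c ≤ r →
        Q (k + 1) (S p k u v - S p' k u v) (l₁ * dist p p' * max ‖u‖ c))
    (hm : ∀ h h' : E 0, ‖h‖ ≤ ρ → ‖h'‖ ≤ ρ → Q 0 (y₀ h - y₀ h') (m₀ * ‖h - h'‖))
    (hAV : ∀ p, p ∈ ball → ∀ k (x : E k), x ∈ V k → A p k x ∈ V (k + 1))
    (hAV' : ∀ p, p ∈ ball → ∀ k (x : E (k + 1)), x ∈ V (k + 1) → (A p k).symm x ∈ V k)
    (hBV : ∀ p, p ∈ ball → ∀ k, k < N → ∀ y : F k, y ∈ W k → B p k y ∈ V (k + 1))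
    (hSW : ∀ p, p ∈ ball → ∀ k, k < N → ∀ (x : E k) (y : F k), x ∈ V k → y ∈ W k → S p k x y ∈ W (k + 1))
    (hy₀W : ∀ h : E 0, ‖h‖ ≤ ρ → h ∈ V 0 → y₀ h ∈ W 0) :
    ∃ h : E 0, h ∈ V 0 ∧ ‖h‖ ≤ ρ ∧ ∃ x : ∀ k, E k, (∀ k, k ≤ N → x k ∈ V k) ∧
      IsTunedQ N (A (qmap h)) (B (qmap h)) (S (qmap h)) (y₀ h) x ∧
        InTubeQ N η ε Q (S (qmap h)) (y₀ h) x ∧ x 0 = h := by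
  classical
  have hρ : 0 ≤ ρ := hε.trans hερ
  have h0ball : qmap 0 ∈ ball := hmaps 0 (by rw [norm_zero]; exact hρ)
  haveI : ∀ k, CompleteSpace (V k) := fun k => (hVc k).isComplete.completeSpace_coe
  -- the restricted data
  let Λ' := {p : Λ // p ∈ ball}
  have hmapV : ∀ p : Λ', ∀ k, (V k).map ((A p.1 k : E k →ₗ[ℝ] E (k + 1))) = V (k + 1) := by
    intro p k
    ext x
    constructor
    · rintro ⟨y, hy, rfl⟩
      exact hAV p.1 p.2 k y hy
    · intro hx
      exact ⟨(A p.1 k).symm x, hAV' p.1 p.2 k x hx, (A p.1 k).apply_symm_apply x⟩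
  let A' : Λ' → ∀ k, V k ≃L[ℝ] V (k + 1) := fun p k =>
    { (A p.1 k).toLinearEquiv.ofSubmodules (V k) (V (k + 1)) (hmapV p k) with
      continuous_toFun := by
        refine Continuous.subtype_mk ((A p.1 k).continuous.comp continuous_subtype_val) _
      continuous_invFun := by
        refine Continuous.subtype_mk ((A p.1 k).symm.continuous.comp continuous_subtype_val) _ }
  have hA'apply : ∀ (p : Λ') k (x : V k), ((A' p k x : V (k + 1)) : E (k + 1)) = A p.1 k x := fun _ _ _ => rfl
  have hA'symm : ∀ (p : Λ') k (x : V (k + 1)), (((A' p k).symm x : V k) : E k) = (A p.1 k).symm x :=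
    fun _ _ _ => rfl
  let B' : Λ' → ∀ k, W k →+ V (k + 1) := fun p k =>
    if hk : k < N then
      { toFun := fun y => ⟨B p.1 k y.1, hBV p.1 p.2 k hk y.1 y.2⟩
        map_zero' := by ext; simp
        map_add' := fun y y' => by ext; simp }
    else 0
  have hB'apply : ∀ (p : Λ') k, k < N → ∀ y : W k, ((B' p k y : V (k + 1)) : E (k + 1)) = B p.1 k y.1 := by
    intro p k hk y
    simp only [B', dif_pos hk]
    rfl
  let S' : Λ' → ∀ k, V k → W k → W (k + 1) := fun p k x y =>
    if hk : k < N then ⟨S p.1 k x.1 y.1, hSW p.1 p.2 k hk x.1 y.1 x.2 y.2⟩ else 0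
  have hS'apply : ∀ (p : Λ') k, k < N → ∀ (x : V k) (y : W k), ((S' p k x y : W (k + 1)) : F (k + 1)) = S p.1 k x.1 y.1 := by
    intro p k hk x y
    simp only [S', dif_pos hk]
  let y₀' : V 0 → W 0 := fun h => if hh : ‖(h : E 0)‖ ≤ ρ then ⟨y₀ h.1, hy₀W h.1 hh h.2⟩ else 0
  have hy₀'apply : ∀ h : V 0, ‖(h : E 0)‖ ≤ ρ → ((y₀' h : W 0) : F 0) = y₀ h.1 := by
    intro h hh
    simp only [y₀', dif_pos hh]
  let Q' : ∀ k, W k → ℝ → Prop := fun k y c => Q k y.1 c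
  let qmap' : V 0 → Λ' := fun h => if hh : ‖(h : E 0)‖ ≤ ρ then ⟨qmap h.1, hmaps h.1 hh⟩ else ⟨qmap 0, h0ball⟩
  have hqmap' : ∀ h : V 0, ‖(h : E 0)‖ ≤ ρ → (qmap' h).1 = qmap h.1 := by
    intro h hh
    simp only [qmap', dif_pos hh]
  let dist' : Λ' → Λ' → ℝ := fun p p' => dist p.1 p'.1
  -- the predicates
  have hQ' : IsSubaddNormBound (F := fun k => W k) Q' :=
    { mono := fun k y c c' hy hc => hQ.mono k y.1 c c' hy hc
      zero := fun k => by show Q k ((0 : W k) : F k) 0; rw [AddSubgroup.coe_zero]; exact hQ.zero k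
      add := fun k y y' c c' hy hy' => by
        show Q k ((y + y' : W k) : F k) (c + c'); rw [AddSubgroup.coe_add]; exact hQ.add k _ _ _ _ hy hy'
      neg := fun k y c hy => by
        show Q k ((-y : W k) : F k) c; rw [AddSubgroup.coe_neg]; exact hQ.neg k _ _ hy }
  -- the restricted steps satisfy Theorem 6.8
  have hT' : ∀ p : Λ', p ∈ (Set.univ : Set Λ') →
      IsRGStepQ (E := fun k => V k) (F := fun k => W k) N r α β σ Q' (A' p) (B' p) (S' p) := by
    intro p _
    have hTp := hT p.1 p.2
    refine ⟨?_, ?_, ?_, ?_⟩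
    · intro k hk
      apply Subtype.ext
      rw [hS'apply p k hk]
      show S p.1 k ((0 : V k) : E k) ((0 : W k) : F k) = ((0 : W (k + 1)) : F (k + 1))
      rw [Submodule.coe_zero, AddSubgroup.coe_zero, AddSubgroup.coe_zero]
      exact hTp.map_zero k hk
    · intro k hk x x' y y' cy cy' c hx hx' hy hcy hy' hcy' hyy'
      show Q (k + 1) ((S' p k x y - S' p k x' y' : W (k + 1)) : F (k + 1)) (σ * max ‖x - x'‖ c)
      rw [AddSubgroup.coe_sub, hS'apply p k hk, hS'apply p k hk, Submodule.coe_norm, Submodule.coe_sub]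
      have hyy'' : Q k ((y : F k) - (y' : F k)) c := by
        have h0 : Q k ((y - y' : W k) : F k) c := hyy'
        rwa [AddSubgroup.coe_sub] at h0
      exact hTp.lipschitz k hk x.1 x'.1 y.1 y'.1 cy cy' c hx hx' hy hcy hy' hcy' hyy''
    · intro k hk w
      rw [Submodule.coe_norm, Submodule.coe_norm, hA'symm]
      exact hTp.norm_symm_le k hk w.1
    · intro k hk y c hy
      rw [Submodule.coe_norm, hB'apply p k hk]
      exact hTp.norm_B_le k hk y.1 c hy
  -- apply the parametrised Lemma 12.6 to the restricted system
  obtain ⟨h, hh, x, htuned, htube, hx0⟩ :=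
    exists_isTunedQ_initial_eq_of_parametrised (E := fun k => V k) (F := fun k => W k) (Q := Q')
      (A := A') (B := B') (S := S') (y₀ := y₀') (Λ := Λ')
      (r := r) (α := α) (β := β) (σ := σ) (η := η) (κ := κ) (ε := ε) (ρ := ρ)
      (a₁ := a₁) (b₁ := b₁) (l₁ := l₁) (m₀ := m₀) (c₀ := c₀) (Lq := Lq)
      dist' Set.univ qmap' hQ' (fun k hk v c hv => hQnn k hk v.1 c hv) hη hη1 hα hβ hκ₁ hκ₂ hκ hε hεr hερ
      ha1 hb1 hl1 hLq hc₀ (fun _ _ => Set.mem_univ _)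
      (fun h h' hh hh' => by
        show dist (qmap' h).1 (qmap' h').1 ≤ Lq * ‖h - h'‖
        rw [hqmap' h hh, hqmap' h' hh', Submodule.coe_norm, Submodule.coe_sub]
        exact hlip h.1 h'.1 hh hh')
      hT'
      (fun h hh => by
        show Q 0 ((y₀' h : W 0) : F 0) c₀
        rw [hy₀'apply h hh]; exact hy₀ h.1 hh)
      (fun p p' _ _ k hk w => by
        rw [Submodule.coe_norm, Submodule.coe_norm, Submodule.coe_sub, hA'symm, hA'symm]
        exact ha p.1 p'.1 p.2 p'.2 k hk w.1)
      (fun p p' _ _ k hk v c hv => by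
        rw [Submodule.coe_norm, Submodule.coe_sub, hB'apply p k hk, hB'apply p' k hk]
        exact hb p.1 p'.1 p.2 p'.2 k hk v.1 c hv)
      (fun p p' _ _ k hk u v c hu hv hc => by
        show Q (k + 1) ((S' p k u v - S' p' k u v : W (k + 1)) : F (k + 1)) (l₁ * dist p.1 p'.1 * max ‖u‖ c)
        rw [AddSubgroup.coe_sub, hS'apply p k hk, hS'apply p' k hk, Submodule.coe_norm]
        exact hl p.1 p'.1 p.2 p'.2 k hk u.1 v.1 c hu hv hc)
      (fun h h' hh hh' => by
        show Q 0 ((y₀' h - y₀' h' : W 0) : F 0) (m₀ * ‖h - h'‖)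
        rw [AddSubgroup.coe_sub, hy₀'apply h hh, hy₀'apply h' hh', Submodule.coe_norm, Submodule.coe_sub]
        exact hm h.1 h'.1 hh hh')
  -- read off the trajectory in the big spaces
  have hhE : ‖(h : E 0)‖ ≤ ρ := hh
  have hq : (qmap' h).1 = qmap h.1 := hqmap' h hhE
  have hfwd : ∀ k, k ≤ N → ((fwd (S' (qmap' h)) (y₀' h) x k : W k) : F k) =
      fwd (S (qmap h.1)) (y₀ h.1) (fun k => (x k : E k)) k := by
    intro k
    induction k with
    | zero => intro _; rw [fwd_zero, fwd_zero, hy₀'apply h hhE]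
    | succ k ih =>
      intro hk
      rw [fwd_succ, fwd_succ, hS'apply _ k (by omega), ← ih (by omega), hq]
  refine ⟨h.1, h.2, hhE, fun k => (x k : E k), fun k _ => (x k).2, ⟨?_, ?_⟩, ?_, ?_⟩
  · have := htuned.final
    rw [this]; rfl
  · intro k hk
    have := htuned.rel k hk
    have h1 : ((x (k + 1) : V (k + 1)) : E (k + 1)) = ((A' (qmap' h) k (x k) + B' (qmap' h) k (fwd (S' (qmap' h)) (y₀' h) x k) : V (k + 1)) : E (k + 1)) := by
      rw [this]
    rw [Submodule.coe_add, hA'apply, hB'apply _ k hk, hfwd k hk.le, hq] at h1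
    exact h1
  · intro k hk
    obtain ⟨h1, h2⟩ := htube k hk
    refine ⟨?_, ?_⟩
    · rw [← Submodule.coe_norm]; exact h1
    · have h3 : Q k ((fwd (S' (qmap' h)) (y₀' h) x k : W k) : F k) (ε * η ^ k) := h2
      rwa [hfwd k hk] at h3
  · show ((x 0 : V 0) : E 0) = (h : E 0)
    rw [hx0]

end invariant

end RGFlow

end Literature.Dynamics.Hyperbolic

end
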